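import Summits.CriticalPhenomena.CardyFormulaZ2.Theorems.CardyIKTransportIKLinearTransportSDECore8

/-!
# Stub `stub_StripDiagramExchange` — core part 9: the sandwich and the core identity

Continues `…SDECore8`. THE SANDWICH `SDE.core_le`: for boundary-condition + prescribed-connection events,
`P(E_∞(τ)) ≤ P(E_∞(¬τ))` — window event `⊆` cylinder event (exchanged by `DiagramExchangeAt N`) `⊆` window event `∪`
exit, the mixing limit `N → ∞`, the exit bound, and the increasing limit of the windows. Hence equality for positive
cylinder events, for mixed ones by inclusion–exclusion, and THE CORE IDENTITY `SDE.core_map_eq`: the joint law of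
(boundary colourings, strip diagram) of the explicit strip model is the same for the two column-type orders
(uniqueness of projective limits on the coded output).
-/

set_option autoImplicit false

noncomputable section

namespace Summit.CriticalPhenomena.CardyFormulaZ2.Theorems.IKLinearTransport.PinnedDiagramExchange

open scoped Classical MeasureTheory ENNReal ProbabilityTheory BigOperators
open MeasureTheory Literature.Probability.Percolation Literature.Probability.LatticeModels

namespace SDE

/-! ## §21 The sandwich: `P(E_∞(τ)) ≤ P(E_∞(¬τ))` -/

/-- The cylinder events of the two column-type orders have equal probability. [folklore] -/
theorem P_Ecyl_exchange (hDX : ∀ (L : ℕ) [NeZero L], 3 ≤ L → DiagramExchangeAt L) (i : ℤ) (τ κ₀ κ₂ : Bool)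
    (F₁ F₂ : Finset ℤ) (g₁ g₂ : ℤ → Bool) (Pp : Finset (Site 2 × Site 2)) (N : ℕ) (hN : 4 ≤ N) :
    P (Ecyl i τ κ₀ κ₂ F₁ F₂ g₁ g₂ Pp N) = P (Ecyl i (!τ) κ₀ κ₂ F₁ F₂ g₁ g₂ Pp N) := by
  haveI : NeZero N := ⟨by omega⟩
  obtain ⟨-, -, ha0, ha0'⟩ := aN_bounds N 0 (by omega)
  have h := P_cyl_exchange (hDX N (by omega)) (aN N) κ₀ κ₂ ha0 ha0' (· ∈ Fcyl i (aN N) N F₁ F₂ g₁ g₂ Pp)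
    (Fcyl_shape i (aN N) N F₁ F₂ g₁ g₂ Pp)
  cases τ
  · exact h.symm
  · exact h

/-- A bound for the rows read by the data `(F₁, F₂, P)`. [folklore] -/
def nBd (F₁ F₂ : Finset ℤ) (Pp : Finset (Site 2 × Site 2)) : ℕ :=
  (F₁ ∪ F₂).sup (fun y => y.natAbs) ⊔ Pp.sup (fun pq => max (pq.1 1).natAbs (pq.2 1).natAbs)

/-- The bound bounds. [folklore] -/
theorem nBd_spec (F₁ F₂ : Finset ℤ) (Pp : Finset (Site 2 × Site 2)) :
    (∀ y ∈ F₁ ∪ F₂, -(nBd F₁ F₂ Pp : ℤ) ≤ y ∧ y ≤ nBd F₁ F₂ Pp) ∧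
    ∀ pq ∈ Pp, (-(nBd F₁ F₂ Pp : ℤ) ≤ pq.1 1 ∧ pq.1 1 ≤ nBd F₁ F₂ Pp) ∧ (-(nBd F₁ F₂ Pp : ℤ) ≤ pq.2 1 ∧ pq.2 1 ≤ nBd F₁ F₂ Pp) := by
  constructor
  · intro y hy
    have : y.natAbs ≤ nBd F₁ F₂ Pp := (Finset.le_sup (f := fun y : ℤ => y.natAbs) hy).trans le_sup_left
    omega
  · intro pq hpq
    have : max (pq.1 1).natAbs (pq.2 1).natAbs ≤ nBd F₁ F₂ Pp :=
      (Finset.le_sup (f := fun pq : Site 2 × Site 2 => max (pq.1 1).natAbs (pq.2 1).natAbs) hpq).trans le_sup_right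
    omega

/-- STEP 1 of the sandwich: window events compared through the cylinder, the mixing limit taken. [folklore] -/
theorem sandwich_step (hDX : ∀ (L : ℕ) [NeZero L], 3 ≤ L → DiagramExchangeAt L) (i : ℤ) (τ κ₀ κ₂ : Bool)
    (F₁ F₂ : Finset ℤ) (g₁ g₂ : ℤ → Bool) (Pp : Finset (Site 2 × Site 2))
    (hbd : ∀ pq ∈ Pp, (pq.1 0 = i ∨ pq.1 0 = i + 2) ∧ (pq.2 0 = i ∨ pq.2 0 = i + 2))
    (m m' : ℕ) (hm : nBd F₁ F₂ Pp ≤ m) (hm' : nBd F₁ F₂ Pp ≤ m') :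
    P.real (Ewin i τ κ₀ κ₂ F₁ F₂ g₁ g₂ Pp m) ≤
      P.real (Ewin i (!τ) κ₀ κ₂ F₁ F₂ g₁ g₂ Pp m') + P.real (Gex i (!τ) κ₀ κ₂ Pp m') := by
  obtain ⟨hF, hPp⟩ := nBd_spec F₁ F₂ Pp
  set M := max m m' with hMdef
  have hE1 := Ewin_det i τ κ₀ κ₂ F₁ F₂ g₁ g₂ Pp m M (le_max_left _ _) (fun y hy => by have := hF y hy; omega)
  have hE2 := Ewin_det i (!τ) κ₀ κ₂ F₁ F₂ g₁ g₂ Pp m' M (le_max_right _ _) (fun y hy => by have := hF y hy; omega)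
  have hE3 := Gex_det i (!τ) κ₀ κ₂ Pp m' M (le_max_right _ _) (fun pq hpq => ⟨(hbd pq hpq).1, (hbd pq hpq).2,
    by have := (hPp pq hpq).1; omega, by have := (hPp pq hpq).2; omega⟩)
  have hineq : ∀ N, 2 * M + 4 ≤ N → P.real (Ewin i τ κ₀ κ₂ F₁ F₂ g₁ g₂ Pp m ∩ Per (aN N) N) ≤
      P.real (Ewin i (!τ) κ₀ κ₂ F₁ F₂ g₁ g₂ Pp m' ∩ Per (aN N) N) + P.real (Gex i (!τ) κ₀ κ₂ Pp m' ∩ Per (aN N) N) := by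
    intro N hN
    haveI : NeZero N := ⟨by omega⟩
    calc P.real (Ewin i τ κ₀ κ₂ F₁ F₂ g₁ g₂ Pp m ∩ Per (aN N) N)
        ≤ P.real (Ecyl i τ κ₀ κ₂ F₁ F₂ g₁ g₂ Pp N) :=
          measureReal_mono (Ewin_subset_Ecyl i τ κ₀ κ₂ F₁ F₂ g₁ g₂ Pp m N (by omega) (fun y hy => by have := hF y hy; omega))
            (measure_ne_top _ _)
      _ = P.real (Ecyl i (!τ) κ₀ κ₂ F₁ F₂ g₁ g₂ Pp N) := by
          rw [measureReal_def, P_Ecyl_exchange hDX i τ κ₀ κ₂ F₁ F₂ g₁ g₂ Pp N (by omega), measureReal_def]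
      _ ≤ P.real ((Ewin i (!τ) κ₀ κ₂ F₁ F₂ g₁ g₂ Pp m' ∪ Gex i (!τ) κ₀ κ₂ Pp m') ∩ Per (aN N) N) :=
          measureReal_mono (Set.subset_inter (Ecyl_subset i (!τ) κ₀ κ₂ F₁ F₂ g₁ g₂ Pp m' N (by omega)
            (fun y hy => by have := hF y hy; omega) (fun pq hpq => ⟨(hbd pq hpq).1, (hbd pq hpq).2,
              by have := (hPp pq hpq).1; omega, by have := (hPp pq hpq).2; omega⟩)) Set.inter_subset_right)
            (measure_ne_top _ _)
      _ ≤ _ := by rw [Set.union_inter_distrib_right]; exact measureReal_union_le _ _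
  have hq := qI_val
  have hε0 : 0 ≤ 1 - 2 * (qI : ℝ) := by linarith
  have hε1 : 1 - 2 * (qI : ℝ) < 1 := by linarith
  refine le_of_forall_pos_le_add fun δ hδ => ?_
  obtain ⟨t, ht⟩ := exists_pow_lt_of_lt_one (show 0 < δ / 3 by linarith) hε1
  have h1 := mixing M hE1 (2 * M + 4 + t) (by omega)
  have h2 := mixing M hE2 (2 * M + 4 + t) (by omega)
  have h3 := mixing M hE3 (2 * M + 4 + t) (by omega)
  have hNt : 2 * M + 4 + t - 2 * M = t + 4 := by omega
  rw [hNt] at h1 h2 h3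
  have hpow : (1 - 2 * (qI : ℝ)) ^ (t + 4) ≤ (1 - 2 * (qI : ℝ)) ^ t := pow_le_pow_of_le_one hε0 hε1.le (by omega)
  have hi := hineq (2 * M + 4 + t) (by omega)
  rw [abs_le] at h1 h2 h3
  linarith

/-- THE SANDWICH: the target event is not more likely for one column-type order than for the other. [folklore] -/
theorem core_le (hDX : ∀ (L : ℕ) [NeZero L], 3 ≤ L → DiagramExchangeAt L) (i : ℤ) (τ κ₀ κ₂ : Bool)
    (F₁ F₂ : Finset ℤ) (g₁ g₂ : ℤ → Bool) (Pp : Finset (Site 2 × Site 2)) :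
    P.real (Einf i τ κ₀ κ₂ F₁ F₂ g₁ g₂ Pp) ≤ P.real (Einf i (!τ) κ₀ κ₂ F₁ F₂ g₁ g₂ Pp) := by
  by_cases hbd : ∀ pq ∈ Pp, (pq.1 0 = i ∨ pq.1 0 = i + 2) ∧ (pq.2 0 = i ∨ pq.2 0 = i + 2)
  swap
  · have : Einf i τ κ₀ κ₂ F₁ F₂ g₁ g₂ Pp = ∅ := Set.eq_empty_of_forall_notMem fun b hb => hbd fun pq hpq => by
      have := (mem_stripDiagram_iff i _ pq.1 pq.2).1 (hb.2 pq hpq); exact ⟨this.1, this.2.1⟩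
    rw [this, measureReal_empty]; exact measureReal_nonneg
  obtain ⟨hF, hPp⟩ := nBd_spec F₁ F₂ Pp
  set n := nBd F₁ F₂ Pp with hn
  have hq := qI_val
  have hq0 : 0 ≤ (qI : ℝ) := by linarith
  have hr0 : 0 ≤ 1 - (qI : ℝ) ^ 6 := by have : (qI : ℝ) ^ 6 ≤ 1 := pow_le_one₀ hq0 (by linarith); linarith
  have hr1 : 1 - (qI : ℝ) ^ 6 < 1 := by have : 0 < (qI : ℝ) ^ 6 := pow_pos (by linarith) 6; linarith
  -- Step 2: window events of `τ` are dominated by the target event of `¬τ`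
  have step2 : ∀ m, n ≤ m → P.real (Ewin i τ κ₀ κ₂ F₁ F₂ g₁ g₂ Pp m) ≤ P.real (Einf i (!τ) κ₀ κ₂ F₁ F₂ g₁ g₂ Pp) := by
    intro m hm
    refine le_of_forall_pos_le_add fun δ hδ => ?_
    obtain ⟨k, hk⟩ := exists_pow_lt_of_lt_one (show 0 < δ / (2 * Pp.card + 1) by positivity) hr1
    have hs := sandwich_step hDX i τ κ₀ κ₂ F₁ F₂ g₁ g₂ Pp hbd m (n + 2 * k + 2) hm (by omega)
    have hG := P_Gex_le i (!τ) κ₀ κ₂ Pp n (n + 2 * k + 2) k (fun pq hpq => ⟨(hbd pq hpq).1, (hPp pq hpq).1⟩) (by push_cast; omega)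
    have hW : P.real (Ewin i (!τ) κ₀ κ₂ F₁ F₂ g₁ g₂ Pp (n + 2 * k + 2)) ≤ P.real (Einf i (!τ) κ₀ κ₂ F₁ F₂ g₁ g₂ Pp) :=
      measureReal_mono (by rw [← iUnion_Ewin]; exact Set.subset_iUnion _ _) (measure_ne_top _ _)
    have hcard : (0 : ℝ) ≤ Pp.card := Nat.cast_nonneg _
    have : 2 * (Pp.card : ℝ) * (1 - (qI : ℝ) ^ 6) ^ k ≤ δ := by
      have h1 : (1 - (qI : ℝ) ^ 6) ^ k * (2 * Pp.card + 1) < δ := by rwa [lt_div_iff₀ (by positivity)] at hk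
      nlinarith [pow_nonneg hr0 k]
    linarith
  -- Step 3: the target event of `τ` is the increasing limit of its window events
  have hmono : Monotone (fun m => Ewin i τ κ₀ κ₂ F₁ F₂ g₁ g₂ Pp m) := fun m m' h => Ewin_mono i τ κ₀ κ₂ F₁ F₂ g₁ g₂ Pp h
  have htend := tendsto_measure_iUnion_atTop (μ := P) hmono
  rw [iUnion_Ewin] at htend
  have htend' := (ENNReal.tendsto_toReal (measure_ne_top P _)).comp htend
  refine le_of_tendsto htend' (Filter.eventually_atTop.2 ⟨n, fun m hm => ?_⟩)
  exact step2 m hm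


/-! ## §22 From positive to mixed cylinder events, and the equality of the joint laws -/

/-- The diagram-membership events are measurable. [folklore] -/
theorem measurableSet_diag (i : ℤ) (τ κ₀ κ₂ : Bool) (pq : Site 2 × Site 2) :
    MeasurableSet {b : K | pq ∈ stripDiagram i (X i τ κ₀ κ₂ b)} := by
  have e : {b : K | pq ∈ stripDiagram i (X i τ κ₀ κ₂ b)} = ⋃ m : ℕ, {b | pq ∈ DgW i (-m) m (X i τ κ₀ κ₂ b)} := by
    ext b; simp only [Set.mem_setOf_eq, Set.mem_iUnion]
    exact ⟨fun h => exists_DgW i _ h, fun ⟨m, hm⟩ => DgW_subset _ _ _ _ hm⟩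
  rw [e]
  refine MeasurableSet.iUnion fun m => measurableSet_of_det (Jw (-(m : ℤ)) m) fun b b' hb => ?_
  exact ⟨DgW_local i τ κ₀ κ₂ (by omega) (by omega) hb pq,
    DgW_local i τ κ₀ κ₂ (by omega) (by omega) (fun j hj => (hb j hj).symm) pq⟩

/-- The boundary-condition events are measurable. [folklore] -/
theorem measurableSet_Bev (κ₀ κ₂ : Bool) (F₁ F₂ : Finset ℤ) (g₁ g₂ : ℤ → Bool) : MeasurableSet (Bev κ₀ κ₂ F₁ F₂ g₁ g₂) :=
  measurableSet_of_det _ (Bev_det κ₀ κ₂ F₁ F₂ g₁ g₂ (nBd F₁ F₂ ∅) (nBd_spec F₁ F₂ ∅).1)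

/-- MIXED CYLINDER EVENTS: boundary condition, required connections `Pp`, forbidden connections `Pn`. [folklore] -/
def Emix (i : ℤ) (τ κ₀ κ₂ : Bool) (F₁ F₂ : Finset ℤ) (g₁ g₂ : ℤ → Bool) (Pp Pn : Finset (Site 2 × Site 2)) : Set K :=
  Einf i τ κ₀ κ₂ F₁ F₂ g₁ g₂ Pp ∩ {b | ∀ pq ∈ Pn, pq ∉ stripDiagram i (X i τ κ₀ κ₂ b)}

/-- Mixed cylinder events are measurable. [folklore] -/
theorem measurableSet_Emix (i : ℤ) (τ κ₀ κ₂ : Bool) (F₁ F₂ : Finset ℤ) (g₁ g₂ : ℤ → Bool) (Pp Pn : Finset (Site 2 × Site 2)) :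
    MeasurableSet (Emix i τ κ₀ κ₂ F₁ F₂ g₁ g₂ Pp Pn) := by
  refine ((measurableSet_Bev κ₀ κ₂ F₁ F₂ g₁ g₂).inter ?_).inter ?_
  · rw [show {b : K | ∀ pq ∈ Pp, pq ∈ stripDiagram i (X i τ κ₀ κ₂ b)} = ⋂ pq ∈ Pp, {b | pq ∈ stripDiagram i (X i τ κ₀ κ₂ b)} by
      ext b; simp]
    exact Finset.measurableSet_biInter _ fun pq _ => measurableSet_diag i τ κ₀ κ₂ pq
  · rw [show {b : K | ∀ pq ∈ Pn, pq ∉ stripDiagram i (X i τ κ₀ κ₂ b)} = ⋂ pq ∈ Pn, {b | pq ∈ stripDiagram i (X i τ κ₀ κ₂ b)}ᶜ by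
      ext b; simp]
    exact Finset.measurableSet_biInter _ fun pq _ => (measurableSet_diag i τ κ₀ κ₂ pq).compl

/-- EQUALITY FOR POSITIVE CYLINDER EVENTS. [folklore] -/
theorem P_Einf_eq (hDX : ∀ (L : ℕ) [NeZero L], 3 ≤ L → DiagramExchangeAt L) (i : ℤ) (κ₀ κ₂ : Bool)
    (F₁ F₂ : Finset ℤ) (g₁ g₂ : ℤ → Bool) (Pp : Finset (Site 2 × Site 2)) :
    P (Einf i true κ₀ κ₂ F₁ F₂ g₁ g₂ Pp) = P (Einf i false κ₀ κ₂ F₁ F₂ g₁ g₂ Pp) := by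
  have h1 := core_le hDX i true κ₀ κ₂ F₁ F₂ g₁ g₂ Pp
  have h2 := core_le hDX i false κ₀ κ₂ F₁ F₂ g₁ g₂ Pp
  simp only [Bool.not_true, Bool.not_false] at h1 h2
  have e := le_antisymm h1 h2
  rw [measureReal_def, measureReal_def] at e
  exact (ENNReal.toReal_eq_toReal_iff' (measure_ne_top _ _) (measure_ne_top _ _)).1 e

/-- EQUALITY FOR MIXED CYLINDER EVENTS (inclusion–exclusion over the forbidden connections). [folklore] -/
theorem P_Emix_eq (hDX : ∀ (L : ℕ) [NeZero L], 3 ≤ L → DiagramExchangeAt L) (i : ℤ) (κ₀ κ₂ : Bool)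
    (F₁ F₂ : Finset ℤ) (g₁ g₂ : ℤ → Bool) :
    ∀ Pn Pp : Finset (Site 2 × Site 2), P (Emix i true κ₀ κ₂ F₁ F₂ g₁ g₂ Pp Pn) = P (Emix i false κ₀ κ₂ F₁ F₂ g₁ g₂ Pp Pn) := by
  intro Pn
  induction Pn using Finset.induction_on with
  | empty =>
    intro Pp
    have e : ∀ τ, Emix i τ κ₀ κ₂ F₁ F₂ g₁ g₂ Pp ∅ = Einf i τ κ₀ κ₂ F₁ F₂ g₁ g₂ Pp := fun τ => by
      ext b; simp [Emix]
    rw [e, e, P_Einf_eq hDX]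
  | insert e Pn he ih =>
    intro Pp
    have hsplit : ∀ τ, Emix i τ κ₀ κ₂ F₁ F₂ g₁ g₂ Pp (insert e Pn) =
        Emix i τ κ₀ κ₂ F₁ F₂ g₁ g₂ Pp Pn \ Emix i τ κ₀ κ₂ F₁ F₂ g₁ g₂ (insert e Pp) Pn := fun τ => by
      ext b
      simp only [Emix, Einf, Set.mem_sdiff, Set.mem_inter_iff, Set.mem_setOf_eq, Finset.forall_mem_insert]
      tauto
    have hsub : ∀ τ, Emix i τ κ₀ κ₂ F₁ F₂ g₁ g₂ (insert e Pp) Pn ⊆ Emix i τ κ₀ κ₂ F₁ F₂ g₁ g₂ Pp Pn := fun τ b hb => by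
      simp only [Emix, Einf, Set.mem_inter_iff, Set.mem_setOf_eq, Finset.forall_mem_insert] at hb ⊢
      tauto
    rw [hsplit, hsplit, measure_sdiff (hsub true) (measurableSet_Emix i true κ₀ κ₂ F₁ F₂ g₁ g₂ _ _).nullMeasurableSet
      (measure_ne_top _ _), measure_sdiff (hsub false) (measurableSet_Emix i false κ₀ κ₂ F₁ F₂ g₁ g₂ _ _).nullMeasurableSet
      (measure_ne_top _ _), ih, ih]

/-- The coded output: boundary colourings and the strip diagram as a family of bits. [folklore] -/
abbrev Cidx : Type := ℤ ⊕ (ℤ ⊕ (Site 2 × Site 2))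

/-- The coded output map. [folklore] -/
def Outπ (i : ℤ) (τ κ₀ κ₂ : Bool) (b : K) : Cidx → Bool
  | Sum.inl y => (bdry κ₀ κ₂ b).1 y
  | Sum.inr (Sum.inl y) => (bdry κ₀ κ₂ b).2 y
  | Sum.inr (Sum.inr pq) => decide (pq ∈ stripDiagram i (X i τ κ₀ κ₂ b))

/-- Bit statistics reading finitely many bits are measurable. [folklore] -/
theorem measurable_bool_of_det (f : K → Bool) (J : Finset Idx) (h : ∀ b b' : K, (∀ j ∈ J, b j = b' j) → f b = f b') :
    Measurable f :=
  measurable_to_bool (measurableSet_of_det J fun b b' hb => by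
    rw [Set.mem_preimage, Set.mem_preimage, Set.mem_singleton_iff, Set.mem_singleton_iff, h b b' hb])

/-- The coded output map is measurable. [folklore] -/
theorem measurable_Outπ (i : ℤ) (τ κ₀ κ₂ : Bool) : Measurable (Outπ i τ κ₀ κ₂) := by
  refine measurable_pi_lambda _ fun c => ?_
  rcases c with y | y | pq
  · refine measurable_bool_of_det _ (Jw (-(y.natAbs : ℤ)) y.natAbs) fun b b' hb => ?_
    show col true κ₀ κ₂ b 0 y = col true κ₀ κ₂ b' 0 y
    exact col_local true κ₀ κ₂ (by omega) (by omega) hb 0 y (by omega) (by omega)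
  · refine measurable_bool_of_det _ (Jw (-(y.natAbs : ℤ)) y.natAbs) fun b b' hb => ?_
    show col true κ₀ κ₂ b 2 y = col true κ₀ κ₂ b' 2 y
    exact col_local true κ₀ κ₂ (by omega) (by omega) hb 2 y (by omega) (by omega)
  · refine measurable_to_bool ?_
    have : (fun b : K => decide (pq ∈ stripDiagram i (X i τ κ₀ κ₂ b))) ⁻¹' {true} = {b | pq ∈ stripDiagram i (X i τ κ₀ κ₂ b)} := by
      ext b; simp
    show MeasurableSet ((fun b : K => decide (pq ∈ stripDiagram i (X i τ κ₀ κ₂ b))) ⁻¹' {true})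
    rw [this]; exact measurableSet_diag i τ κ₀ κ₂ pq

/-- Finite-dimensional events of the coded output are mixed cylinder events. [folklore] -/
theorem restrict_Outπ_eq (i : ℤ) (τ κ₀ κ₂ : Bool) (J : Finset Cidx) (g : ↥J → Bool) :
    {b : K | J.restrict (Outπ i τ κ₀ κ₂ b) = g} =
      Emix i τ κ₀ κ₂ J.toLeft J.toRight.toLeft
        (fun y => if h : Sum.inl y ∈ J then g ⟨_, h⟩ else false)
        (fun y => if h : Sum.inr (Sum.inl y) ∈ J then g ⟨_, h⟩ else false)
        (J.toRight.toRight.filter fun pq => ∃ h : Sum.inr (Sum.inr pq) ∈ J, g ⟨_, h⟩ = true)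
        (J.toRight.toRight.filter fun pq => ∃ h : Sum.inr (Sum.inr pq) ∈ J, g ⟨_, h⟩ = false) := by
  ext b
  simp only [Set.mem_setOf_eq, funext_iff, Finset.restrict_def, Emix, Einf, Bev, Set.mem_inter_iff, Finset.mem_toLeft,
    Finset.mem_toRight, Finset.mem_filter]
  constructor
  · intro H
    refine ⟨⟨⟨fun y hy => ?_, fun y hy => ?_⟩, fun pq ⟨hpq, h, hg⟩ => ?_⟩, fun pq ⟨hpq, h, hg⟩ => ?_⟩
    · rw [dif_pos hy, ← H ⟨_, hy⟩]; rfl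
    · rw [dif_pos hy, ← H ⟨_, hy⟩]; rfl
    · have e := H ⟨_, h⟩; rw [hg] at e; simpa [Outπ] using e
    · have e := H ⟨_, h⟩; rw [hg] at e; simpa [Outπ] using e
  · rintro ⟨⟨⟨h1, h2⟩, h3⟩, h4⟩ ⟨c, hc⟩
    rcases c with y | y | pq
    · have e := h1 y hc; rw [dif_pos hc] at e; exact e
    · have e := h2 y hc; rw [dif_pos hc] at e; exact e
    · show decide (pq ∈ stripDiagram i (X i τ κ₀ κ₂ b)) = g ⟨_, hc⟩
      cases hg : g ⟨_, hc⟩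
      · have := h4 pq ⟨hc, hc, hg⟩; simpa using this
      · have := h3 pq ⟨hc, hc, hg⟩; simpa using this

/-- THE CORE IDENTITY (coded form): the joint law of (boundary colourings, strip diagram) is the same for the two
column-type orders. [folklore] -/
theorem core_map_eq (hDX : ∀ (L : ℕ) [NeZero L], 3 ≤ L → DiagramExchangeAt L) (i : ℤ) (κ₀ κ₂ : Bool) :
    P.map (Outπ i true κ₀ κ₂) = P.map (Outπ i false κ₀ κ₂) := by
  refine (IsProjectiveLimit.unique (μ := P.map (Outπ i false κ₀ κ₂)) (ν := P.map (Outπ i true κ₀ κ₂))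
    (P := fun J : Finset Cidx => (P.map (Outπ i true κ₀ κ₂)).map J.restrict) (fun J => ?_) (fun J => rfl)).symm
  refine Measure.ext_of_singleton fun g => ?_
  rw [Measure.map_apply (Finset.measurable_restrict _) (measurableSet_singleton _),
    Measure.map_apply (Finset.measurable_restrict _) (measurableSet_singleton _),
    Measure.map_apply (measurable_Outπ i false κ₀ κ₂) ((measurableSet_singleton _).preimage (Finset.measurable_restrict _)),
    Measure.map_apply (measurable_Outπ i true κ₀ κ₂) ((measurableSet_singleton _).preimage (Finset.measurable_restrict _))]
  show P {b : K | J.restrict (Outπ i false κ₀ κ₂ b) = g} = P {b : K | J.restrict (Outπ i true κ₀ κ₂ b) = g}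
  rw [restrict_Outπ_eq, restrict_Outπ_eq, P_Emix_eq hDX]


end SDE

/-- THE CORE IDENTITY (part 9 of `stub_StripDiagramExchange`): under `DiagramExchangeAt` on all cylinders, the joint law of (boundary colourings, strip diagram) of the explicit strip model does not depend on the order of the two column types. [folklore] -/
theorem stripDX_coreIdentity : (∀ (L : ℕ) [NeZero L], 3 ≤ L → DiagramExchangeAt L) → ∀ (i : ℤ) (κ₀ κ₂ : Bool), SDE.P.map (SDE.Outπ i true κ₀ κ₂) = SDE.P.map (SDE.Outπ i false κ₀ κ₂) :=
  fun hDX i κ₀ κ₂ => SDE.core_map_eq hDX i κ₀ κ₂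

end Summit.CriticalPhenomena.CardyFormulaZ2.Theorems.IKLinearTransport.PinnedDiagramExchange
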